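import Literature.Computability.QuantumComplexity.PathModelEncodedQubits
import Literature.Computability.QuantumComplexity.SolovayKitaev.Basic
import HarnessLib

/-!
# Approximate intertwiners for encoded qubits: the error calculus of the Jones-hardness reduction

Topic `Literature/Computability/QuantumComplexity`; sibling proof file of
`PathModelEncodedQubits.lean` (the code isometry `encIso N : |x⟩ ↦ |enc x⟩` of `N` qubits into
`4N` strands of the `k = 5` path model, `encIsoᴴ encIso = 1`, and the EXACT intertwining of the
in-block braid generators). The `PromiseBQP`-hardness reduction of Aharonov–Arad (2011, §3.2,
Claim 3.1: "the error accumulates at most linearly in the number of gates") replaces every gate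
`U_t` of a circuit by a braid segment `w_t` whose path-model operator `W_t = φ(w_t)` intertwines
the code isometry only approximately, `‖W_t E - E U_t‖ ≤ δ_t`. This file is the bookkeeping of that
argument in the `L²`-operator norm (`open scoped Matrix.Norms.L2Operator`), for an arbitrary
isometry `E` (`Eᴴ E = 1`) between finite coordinate spaces:

* `norm_le_one_of_isometry`, `norm_apply_le_l2_opNorm`: `‖E‖ ≤ 1`, entries are bounded by the
  norm (rectangular versions of the toolkit of `SolovayKitaev/Basic.lean`);
* `norm_mul_mul_sub_mul_mul_le` (**composition**): defects add along products when the actual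
  factors and the ideal factors are contractions (`W₁W₂E - EU₁U₂ = W₁(W₂E - EU₂) + (W₁E - EU₁)U₂`),
  and `norm_prod_mul_sub_mul_prod_le` for a whole list (error `Σ δ_t`, Aharonov–Arad Claim 3.1;
  Bernstein–Vazirani 1997, §6);
* `norm_conjTranspose_mul_mul_mul_sub_le`, `norm_compress_apply_sub_le` (**readout**):
  `‖Eᴴ W E - U‖ ≤ ‖W E - E U‖`, hence every matrix element of the compressed operator is within the
  defect of the ideal one; with `PathModelEncodedQubits.conjTranspose_encIso_mul_mul_encIso_apply`
  this is `|⟨enc x| W |enc y⟩ - ⟨x|U|y⟩| ≤ δ`, and in particular (`x = y = 0`,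
  `encodeBits_zero`) `| |⟨α|φ(b)|α⟩| - |⟨0|U|0⟩| | ≤ δ` (`abs_norm_apply_encodeBits_sub_le`) — the
  normalised Jones value `ajlRatio 5 (4N) b = |⟨α|φ(b)|α⟩|` (`ajlRatio_eq_norm`) is within `δ` of the
  modulus of the circuit amplitude;
* `norm_ajlCrossingMatrix_blockGen_mul_encIso_sub` : in-block generators have defect `0`.

No definitions and no new statements of results are introduced; everything is proved.

## References

* D. Aharonov, I. Arad, New J. Phys. 13 (2011) 035019; arXiv:quant-ph/0605181, §3.2, Claim 3.1
  [AharonovArad2011].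
* E. Bernstein, U. Vazirani, *Quantum complexity theory*, SIAM J. Comput. 26 (1997), §6
  [BernsteinVazirani1997].
-/

noncomputable section

open scoped Matrix.Norms.L2Operator

namespace Literature.Computability.QuantumComplexity

open Matrix Cryptography

section Generic

variable {m n : Type*} [Fintype m] [DecidableEq m] [Fintype n] [DecidableEq n]

omit [DecidableEq m] in
/-- Every entry of a rectangular matrix is bounded by its `L²`-operator norm. [folklore] -/
theorem norm_apply_le_l2_opNorm (A : Matrix m n ℂ) (i : m) (j : n) : ‖A i j‖ ≤ ‖A‖ := by
  have h := Matrix.l2_opNorm_mulVec A (EuclideanSpace.single j (1 : ℂ))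
  have h1 : ‖(EuclideanSpace.single j (1 : ℂ))‖ = 1 := by simp
  rw [h1, mul_one] at h
  refine le_trans ?_ h
  refine le_trans (le_of_eq ?_) (PiLp.norm_apply_le _ i)
  simp

omit [DecidableEq m] in
/-- **An isometry has norm `≤ 1`** (`‖E‖² = ‖Eᴴ E‖ = ‖1‖ ≤ 1`). [folklore] -/
theorem norm_le_one_of_isometry {E : Matrix m n ℂ} (hE : Eᴴ * E = 1) : ‖E‖ ≤ 1 := by
  have h := Matrix.l2_opNorm_conjTranspose_mul_self E
  rw [hE] at h
  have h1 : ‖(1 : Matrix n n ℂ)‖ ≤ 1 := SolovayKitaev.norm_one_le_one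
  nlinarith [norm_nonneg E]

/-- The adjoint of an isometry has norm `≤ 1`. [folklore] -/
theorem norm_conjTranspose_le_one_of_isometry {E : Matrix m n ℂ} (hE : Eᴴ * E = 1) :
    ‖Eᴴ‖ ≤ 1 := by
  rw [Matrix.l2_opNorm_conjTranspose]; exact norm_le_one_of_isometry hE

/-- **Composition of approximate intertwiners**: if `‖W₁ E - E U₁‖ ≤ δ₁`, `‖W₂ E - E U₂‖ ≤ δ₂`,
`‖W₁‖ ≤ 1` and `‖U₂‖ ≤ 1`, then `‖W₁ W₂ E - E (U₁ U₂)‖ ≤ δ₁ + δ₂`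
(`W₁W₂E - EU₁U₂ = W₁(W₂E - EU₂) + (W₁E - EU₁)U₂`). [cite: AharonovArad2011, Claim 3.1] -/
theorem norm_mul_mul_sub_mul_mul_le {E : Matrix m n ℂ} {W₁ W₂ : Matrix m m ℂ} {U₁ U₂ : Matrix n n ℂ}
    {δ₁ δ₂ : ℝ} (h₁ : ‖W₁ * E - E * U₁‖ ≤ δ₁) (h₂ : ‖W₂ * E - E * U₂‖ ≤ δ₂) (hW : ‖W₁‖ ≤ 1)
    (hU : ‖U₂‖ ≤ 1) : ‖W₁ * W₂ * E - E * (U₁ * U₂)‖ ≤ δ₁ + δ₂ := by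
  have e : W₁ * W₂ * E - E * (U₁ * U₂) = W₁ * (W₂ * E - E * U₂) + (W₁ * E - E * U₁) * U₂ := by
    simp only [Matrix.mul_sub, Matrix.sub_mul, Matrix.mul_assoc]; abel
  rw [e]
  have hδ₁ : 0 ≤ δ₁ := (norm_nonneg _).trans h₁
  have hδ₂ : 0 ≤ δ₂ := (norm_nonneg _).trans h₂
  calc ‖W₁ * (W₂ * E - E * U₂) + (W₁ * E - E * U₁) * U₂‖
      ≤ ‖W₁ * (W₂ * E - E * U₂)‖ + ‖(W₁ * E - E * U₁) * U₂‖ := norm_add_le _ _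
    _ ≤ ‖W₁‖ * ‖W₂ * E - E * U₂‖ + ‖W₁ * E - E * U₁‖ * ‖U₂‖ :=
        add_le_add (Matrix.l2_opNorm_mul _ _) (Matrix.l2_opNorm_mul _ _)
    _ ≤ 1 * δ₂ + δ₁ * 1 := by
        gcongr
    _ = δ₁ + δ₂ := by ring

/-- **Defects add along a product** (Aharonov–Arad Claim 3.1: the error of the whole braid is at
most the sum of the errors of its segments): for a list of triples `(W_t, U_t, δ_t)` of a
contraction `W_t`, a contraction `U_t` and a bound `‖W_t E - E U_t‖ ≤ δ_t`,
`‖(∏ W_t) E - E (∏ U_t)‖ ≤ Σ δ_t`. [cite: AharonovArad2011, Claim 3.1] -/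
theorem norm_prod_mul_sub_mul_prod_le {E : Matrix m n ℂ} (L : List (Matrix m m ℂ × Matrix n n ℂ × ℝ))
    (h : ∀ t ∈ L, ‖t.1‖ ≤ 1 ∧ ‖t.2.1‖ ≤ 1 ∧ ‖t.1 * E - E * t.2.1‖ ≤ t.2.2) :
    ‖(L.map (·.1)).prod * E - E * (L.map (·.2.1)).prod‖ ≤ (L.map (·.2.2)).sum := by
  induction L with
  | nil => simp
  | cons t L ih =>
    simp only [List.map_cons, List.prod_cons, List.sum_cons]
    have ht := h t (by simp)
    have hL : ∀ s ∈ L, ‖s.1‖ ≤ 1 ∧ ‖s.2.1‖ ≤ 1 ∧ ‖s.1 * E - E * s.2.1‖ ≤ s.2.2 :=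
      fun s hs => h s (by simp [hs])
    have hU : ‖(L.map (·.2.1)).prod‖ ≤ 1 :=
      SolovayKitaev.norm_list_prod_le_one L (·.2.1) fun s hs => (hL s hs).2.1
    exact norm_mul_mul_sub_mul_mul_le ht.2.2 (ih hL) ht.1 hU

/-- **Readout: compression to the code space**: `‖Eᴴ W E - U‖ ≤ ‖W E - E U‖` for an isometry `E`
(`Eᴴ W E - U = Eᴴ (W E - E U)` and `‖Eᴴ‖ ≤ 1`). [cite: AharonovArad2011, §3.2] -/
theorem norm_conjTranspose_mul_mul_mul_sub_le {E : Matrix m n ℂ} (hE : Eᴴ * E = 1)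
    (W : Matrix m m ℂ) (U : Matrix n n ℂ) : ‖Eᴴ * W * E - U‖ ≤ ‖W * E - E * U‖ := by
  have e : Eᴴ * W * E - U = Eᴴ * (W * E - E * U) := by
    rw [Matrix.mul_sub, ← Matrix.mul_assoc, ← Matrix.mul_assoc, hE, Matrix.one_mul, Matrix.mul_assoc]
  rw [e]
  calc ‖Eᴴ * (W * E - E * U)‖ ≤ ‖Eᴴ‖ * ‖W * E - E * U‖ := Matrix.l2_opNorm_mul _ _
    _ ≤ 1 * ‖W * E - E * U‖ := by gcongr; exact norm_conjTranspose_le_one_of_isometry hE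
    _ = _ := one_mul _

/-- **Readout, entrywise**: every matrix element of the compressed operator is within the defect
of the ideal one, `|(Eᴴ W E) x y - U x y| ≤ ‖W E - E U‖`. [cite: AharonovArad2011, §3.2] -/
theorem norm_compress_apply_sub_le {E : Matrix m n ℂ} (hE : Eᴴ * E = 1)
    (W : Matrix m m ℂ) (U : Matrix n n ℂ) (x y : n) : ‖(Eᴴ * W * E) x y - U x y‖ ≤ ‖W * E - E * U‖ := by
  have := norm_apply_le_l2_opNorm (Eᴴ * W * E - U) x y
  rw [Matrix.sub_apply] at this
  exact this.trans (norm_conjTranspose_mul_mul_mul_sub_le hE W U)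

omit [DecidableEq m] in
/-- An exact intertwiner has defect `0`. [folklore] -/
theorem norm_mul_sub_mul_eq_zero_of_eq {E : Matrix m n ℂ} {W : Matrix m m ℂ} {U : Matrix n n ℂ}
    (h : W * E = E * U) : ‖W * E - E * U‖ ≤ 0 := by
  rw [h, sub_self, norm_zero]

end Generic

/-! ### Specialisation to the code isometry of `PathModelEncodedQubits.lean` -/

variable {N : ℕ}

/-- **Matrix elements of a braid operator between encoded basis states are within the defect of
the ideal gate**: `|⟨enc x| W |enc y⟩ - ⟨x|U|y⟩| ≤ ‖W · encIso - encIso · U‖`.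
[cite: AharonovArad2011, §3.2 and Claim 3.1] -/
theorem norm_apply_encodeBits_sub_le (W : Matrix (QReg (N * 4)) (QReg (N * 4)) ℂ)
    (U : Matrix (QReg N) (QReg N) ℂ) (x y : QReg N) :
    ‖W (encodeBits x) (encodeBits y) - U x y‖ ≤ ‖W * encIso N - encIso N * U‖ := by
  have h := norm_compress_apply_sub_le conjTranspose_encIso_mul_encIso W U x y
  rwa [conjTranspose_encIso_mul_mul_encIso_apply] at h

/-- **The Jones value is within the defect of the circuit amplitude**: with `α = enc 0…0`
(`encodeBits_zero`), `| |⟨α| W |α⟩| - |⟨0|U|0⟩| | ≤ ‖W · encIso - encIso · U‖` (reverse triangle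
inequality). For `W = φ(b)` the left modulus is `ajlRatio 5 (4N) b` (`ajlRatio_eq_norm`).
[cite: AharonovArad2011, §3.2 and Claim 3.1] -/
theorem abs_norm_apply_ajlAlpha_sub_le (W : Matrix (QReg (N * 4)) (QReg (N * 4)) ℂ)
    (U : Matrix (QReg N) (QReg N) ℂ) :
    |‖W (ajlAlpha (N * 4)) (ajlAlpha (N * 4))‖ - ‖U (fun _ => false) (fun _ => false)‖| ≤
      ‖W * encIso N - encIso N * U‖ := by
  rw [← encodeBits_zero]
  exact (abs_norm_sub_norm_le _ _).trans (norm_apply_encodeBits_sub_le W U _ _)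

/-- **In-block generators have defect `0`**: `‖ρ(σ_{4a+r}^ε) · encIso - encIso · (blockCrossing r ε
on wire a)‖ ≤ 0`. [cite: AharonovArad2011, §3.1 and §3.2] -/
theorem norm_ajlCrossingMatrix_blockGen_mul_encIso_sub (a : Fin N) (r : Fin 3) (ε : Bool) :
    ‖ajlCrossingMatrix 5 (blockGen a r, ε) * encIso N -
        encIso N * placeGate (wireEmb a) (blockCrossing r ε)‖ ≤ 0 :=
  norm_mul_sub_mul_eq_zero_of_eq (ajlCrossingMatrix_blockGen_mul_encIso a r ε)

/-- The crossing matrices are contractions (they are unitary). [cite: AharonovJonesLandau2009, Claim 2.2] -/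
theorem norm_ajlCrossingMatrix_le_one (k : ℕ) {n : ℕ} (g : Fin (n - 1) × Bool) :
    ‖ajlCrossingMatrix k g‖ ≤ 1 :=
  SolovayKitaev.norm_le_one_of_mem_unitaryGroup (ajlCrossingMatrix_mem_unitaryGroup k n g)

/-- Braid-word operators are contractions. [cite: AharonovJonesLandau2009, Claim 3.1] -/
theorem norm_ajlBraidMatrix_le_one (k : ℕ) {n : ℕ} (b : BraidWord n) : ‖ajlBraidMatrix k b‖ ≤ 1 :=
  SolovayKitaev.norm_le_one_of_mem_unitaryGroup (ajlBraidMatrix_mem_unitaryGroup k b)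

end Literature.Computability.QuantumComplexity

end
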